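import Literature.MathematicalPhysics.QuantumFieldTheory.Balaban1983to89.B9QstarLettersAtPins
import Literature.MathematicalPhysics.QuantumFieldTheory.Balaban1983to89.B9Thm313WholeQstarFromG0
import Literature.MathematicalPhysics.QuantumFieldTheory.Balaban1983to89.B9Thm312WholeDir
import Literature.MathematicalPhysics.QuantumFieldTheory.Balaban1983to89.B9Thm312WholeHZ

/-!
# `Balaban1983to89.B9LettersHHZWholeAtPins` — [B9] Theorem 3.12 ∕ 3.13 (pp. 420–426), the H-letter entry `Φ_β ∘ ∇_U G₀ Q*` ((3.126) with (3.43) and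
# the adjoint `Q*` of the averaging operator): THE WHOLE SCHEMA `LettersHHZ` (the N06 certificate's displayed W-c face `hLHH`) AT THE
# CERTIFICATE'S PINS IN ONE TERM — every member, every `Reg335` configuration, every `0 ≤ β < 1`

T. Bałaban, *Propagators for lattice gauge theories in a background field*, Commun. Math. Phys. **99** (1985) 389–434
[`Balaban1985BackgroundPropagators`, "B9"]; [4] = T. Bałaban, *Propagators and renormalization transformations for lattice gauge
theories. II*, Commun. Math. Phys. **96** (1984) 223–250 [`Balaban1984PropagatorsII`].

statement-level skeleton of published theorems with citation tags; proofs where landed; nothing here is a claim about the Yang–Mills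
mass gap

THE POINT (cell `pub-ymgap`, node N06 [B9]; width seat w5, W-c face `hLHH`).  The stage-11 certificate of record (dag-n06-d, editions ≥ 22) displays
`hLHH : … → LettersHHZ (𝔬12 x) (𝔭A x) 1 (H x) (fun y => (geo9Y_len_pos x y).le) (weightNorm (BlockNorm.ofBlocks (toB6 (geo9Y x) 1 (H x)) (𝔬12 x).blkZ) n⁻¹ _) Bq12 δ12₃ U`
(`B9Thm312WholeHZ.LettersHHZ`, one field `pQ β`: the Hölder probe `Φ^Y_β ∘ ∇_U ∘ G₀ ∘ Q*` out of the weighted averaging class `Z_{n⁻¹}` into the probe class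
`𝔠_P^{(β−1)}`, constant `Bq β·e^{−δ₃d}`).  dag-n06-l's schema lemma `B9Thm313WholeQstarFromG0.pQ_of_h43` reduces it to a (3.43)-shape probe majorant of
`Φ^Y_β ∘ ∇_U ∘ G₀` and a sup letter of `Q*`; the former IS the field `h43L β` of the rows-19-derived direction members `Thm33G0Dir` (in the certificate:
`(hG0C x …).1` of `N06G0LayerFromThm310AtPinsE.g0_layer_of_thm310_coreB`), the latter is this seat's `B9QstarLettersAtPins.hasMaj_Qstar_pins` (g0) at
node00-def-Y's coordinate model `QscoKH` of `Q*`.  THIS FILE composes them BY NAME: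
* ★★★ `lettersHHZ_pins` — at a member `x`, for Sect.-D letters `𝔬` with the pins `hblk : 𝔬.blk = blkBK bI`, `hblkZ : 𝔬.blkZ = blkHK`,
  `hQs : 𝔬.Qstar U = QscoKH … (parBY x.toKIdx) U`, `bI` 1-faithful (`hβ1`), `U ∈ Reg335` (`SU(N)`-valued, so the taxi transporters contract), the row-sum letter
  `hrow` and ONE analytic input `hH0 : Thm33G0Dir 𝔬 𝔭 Dd Dds 1 H bHX B₀ Bh Bi Bi2 δ₀ U` (HYPOTHESIS): `LettersHHZ 𝔬 𝔭 1 H _ (weightNorm (ofBlocks 𝔬.blkZ) n⁻¹ _) Bq δ₃ U`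
  for ANY `Bq β ≥ Bh β·e^{δ_Q(ℓ+4)}·c` and rates `0 ≤ δ₃ ≤ δ₀`, `δ₃ + σ ≤ δ_Q`, `0 ≤ δ_Q`;
* ★★ `lettersHHZ_pins_closed` — the same at the closed letter `Bq β := Bh β·e^{δ_Q(ℓ+4)}·c`.
KNIT (dag-n06-d, a later edition): `hLHH := fun x hM α₀ hα ha U hU hU' => lettersHHZ_pins x (hβ1 x) hU hrow hc hBh hδQ hδ₃ hδ₃0 hδ₃Q hBq (hblk12 x) (hblkZ12 x)
(hQsco12 x U) (hG0C x hM α₀ hα ha U hU hU').1` — the displayed binder `hLHH` leaves; `Bq12` becomes a letter of `Bh12` after the `obtain`.  With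
`B9Thm33G0DivRWholeAtPins.thm33G0DivR_pins` (face `hdiv`) this closes BOTH W-c faces assigned to this seat at the pins.

HONEST SCOPE.  By-name composition of two landed helper files (p608208, n06-l's `B9Thm313WholeQstarFromG0`); nothing of [B9]'s propagator estimates asserted:
`Thm33G0Dir` (rows 19's content) is a HYPOTHESIS here; COUNT-NEUTRAL; N06 is NOT discharged; one finite lattice at a time; nothing continuum, nothing about the
mass gap ∕ Clay.  Cell `pub-ymgap` (HUMAN RULING D-0062 ∕ D-0154), Track A node N06 [B9], width seat `pub-ymgap-dag-n06-w5` (g2), 2026-08-28.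
-/

noncomputable section

namespace Literature.MathematicalPhysics.QuantumFieldTheory.Balaban1983to89.B9LettersHHZWholeAtPins

open scoped Matrix.Norms.L2Operator
open Node00 B6GlobalChartV1 B6KLevelCensusIndexV1
open B6Geom246MultiLevelTorus (geomT)
open B6Ineq2142KLevelV1 (β lvl)
open B7Prop2SpecialUnitary (specialUnitaryUnits)
open B9PinMembersKLevelV1 (MemberY geo9Y bg9Y)
open B9CoReadingCoordsTranspose (TrIdx trBasis)
open B9CoReadingCoords (XBK blkBK)
open B9CoReadingCoordsH (XHK blkHK)
open B9GeoNormsKLevelV1 (geo9K geo9K_dist_nonneg)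
open B9GeoLemma21KLevelV1 (geo9Y_dist_triangle geo9Y_dist_comm geo9Y_len_pos)
open B9Thm34Ext (toB6)
open B9SectDSup (weightNorm)
open B11SectG (HasMaj BlockNorm RowSum)
open B9Thm312Whole (Ops GeoOK)
open B9RWSums343Holder (HolderProbes)
open B9Thm312WholeDir (Thm33G0Dir)
open B9Thm312WholeHZ (LettersHHZ)
open Node00.OpsYSectDCoords (QscoKH)
open B9QstarLettersAtPins (hasMaj_Qstar_pins)
open B9Thm313WholeQstarFromG0 (pQ_of_h43)

variable {d ℓ : ℕ} {hd : 1 ≤ d + 1} {hL : Odd (ℓ + 1) ∧ 1 < ℓ + 1} {b₀ b₁ : ℝ} {Mstar : ℕ} {N : ℕ} [NeZero N]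
variable [∀ x : MemberY d ℓ hd hL b₀ b₁ Mstar, Fintype (geo9Y x).Site]

/-- ★★★ **THE WHOLE W-c FACE `hLHH` AT THE CERTIFICATE'S PINS** — `LettersHHZ 𝔬 𝔭 1 H _ (weightNorm (ofBlocks 𝔬.blkZ) n⁻¹ _) Bq δ₃ U` (the Hölder probe
`Φ^Y_β ∘ ∇_U ∘ G₀ ∘ Q*` out of the weighted averaging class into `𝔠_P^{(β−1)}`, every `0 ≤ β < 1`) from the rows-19 direction members `hH0 : Thm33G0Dir …`
(HYPOTHESIS; its field `h43L β`), this seat's `Q*`-letter `B9QstarLettersAtPins.hasMaj_Qstar_pins` at rate `δ_Q` and dag-n06-l's `B9Thm313WholeQstarFromG0.pQ_of_h43`,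
for any `Bq β ≥ Bh β·e^{δ_Q(ℓ+4)}·c` and rates `0 ≤ δ₃ ≤ δ₀`, `δ₃ + σ ≤ δ_Q`, `0 ≤ δ_Q`.
[cite: Balaban1985BackgroundPropagators, (3.126) p.420 + (3.43) p.398 + (3.40) p.397 + (3.153) p.426 + (3.35) p.396 + (3.8) p.392; Balaban1984PropagatorsII, (2.51)–(2.56) pp.232–233 + Lemma 2.1 (2.60)–(2.61) p.234] -/
theorem lettersHHZ_pins (x : MemberY d ℓ hd hL b₀ b₁ Mstar) {bI : FBondY x.toKIdx → IBondY x.toKIdx}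
    (hβ1 : ∀ f : FBondY x.toKIdx, (geomT x.D).dist (β x.hN x.D x.hk (bI f)) (blkV1 x.hN x.D f) ≤ 1)
    {Y W PX PY P : Type} [Fintype Y] [Fintype W] [Fintype PX] [Fintype PY]
    {𝔬 : Ops (geo9Y x) (bg9Y (Matrix (Fin N) (Fin N) ℂ) (specialUnitaryUnits (Fin N)) x) (XBK (TrIdx N) x.toKIdx) Y (XHK (TrIdx N) x.toKIdx) W}
    {𝔭 : HolderProbes (geo9Y x) (bg9Y (Matrix (Fin N) (Fin N) ℂ) (specialUnitaryUnits (Fin N)) x) (XBK (TrIdx N) x.toKIdx) Y PX PY}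
    {Dd Dds : (bg9Y (Matrix (Fin N) (Fin N) ℂ) (specialUnitaryUnits (Fin N)) x).Cfg → P → Module.End ℝ (XBK (TrIdx N) x.toKIdx → ℝ)}
    {H : Prop} {bHX : ℝ → BlockNorm (toB6 (geo9Y x) 1 H) (XBK (TrIdx N) x.toKIdx → ℝ)}
    {B₀ : ℝ} {Bh Bi : ℝ → ℝ} {Bi2 : ℝ → ℝ → ℝ} {δ₀ σ c δ₃ δQ c35 α₀ : ℝ} {Bq : ℝ → ℝ}
    {U : (bg9Y (Matrix (Fin N) (Fin N) ℂ) (specialUnitaryUnits (Fin N)) x).Cfg}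
    (hU : (bg9Y (Matrix (Fin N) (Fin N) ℂ) (specialUnitaryUnits (Fin N)) x).Reg335 c35 α₀ U)
    (hrow : RowSum (toB6 (geo9Y x) 1 H) σ c) (hc : 0 ≤ c) (hBh : ∀ β, 0 ≤ β → β < 1 → 0 ≤ Bh β)
    (hδQ : 0 ≤ δQ) (hδ₃ : 0 ≤ δ₃) (hδ₃0 : δ₃ ≤ δ₀) (hδ₃Q : δ₃ + σ ≤ δQ)
    (hBq : ∀ β, 0 ≤ β → β < 1 → Bh β * Real.exp (δQ * ((ℓ : ℝ) + 4)) * c ≤ Bq β)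
    (hblk : 𝔬.blk = blkBK x.toKIdx bI) (hblkZ : 𝔬.blkZ = blkHK x.toKIdx)
    (hQs : 𝔬.Qstar U = QscoKH x.toKIdx (trBasis N) (bg9Y (Matrix (Fin N) (Fin N) ℂ) (specialUnitaryUnits (Fin N)) x) (fun U => U) (parBY x.toKIdx) U)
    (hH0 : Thm33G0Dir 𝔬 𝔭 Dd Dds 1 H bHX B₀ Bh Bi Bi2 δ₀ U)
    (hpl : ∀ y : (geo9Y x).Site, 0 ≤ ((((ℓ + 1 : ℕ) : ℝ) ^ (d + 1)) ^ lvl x.hN x.D x.hk y)⁻¹) :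
    LettersHHZ 𝔬 𝔭 1 H (fun y => (geo9Y_len_pos x y).le)
      (weightNorm (BlockNorm.ofBlocks (toB6 (geo9Y x) 1 H) 𝔬.blkZ) (fun y => ((((ℓ + 1 : ℕ) : ℝ) ^ (d + 1)) ^ lvl x.hN x.D x.hk y)⁻¹) hpl) Bq δ₃ U := by
  letI : Fintype (geo9K x.toKIdx).Site := (inferInstance : Fintype (geo9Y x).Site)
  have hG : GeoOK (geo9Y x) := ⟨geo9Y_dist_triangle x, geo9Y_dist_comm x, geo9K_dist_nonneg x.toKIdx, geo9Y_len_pos x⟩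
  -- the Q*-letter at rate `δ_Q`, read over the record's block maps `𝔬.blkZ = blkHK`, `𝔬.blk = blkBK bI` and the pinned `𝔬.Qstar U`
  have hqs := hasMaj_Qstar_pins (R₀ := (1 : ℝ)) (H₀ := H) x hβ1 hU hδQ (fun y => (geo9Y_len_pos x y).le) hpl
  rw [← hblkZ, ← hblk, ← hQs] at hqs
  refine ⟨fun β' hβ' hβ'1 => ?_⟩
  exact pQ_of_h43 hG hrow (hBh β' hβ' hβ'1) (Real.exp_nonneg _) hc hδ₃ hδ₃0 hδ₃Q (hBq β' hβ' hβ'1) (hH0.h43L β' hβ' hβ'1) hqs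

/-- ★★ **THE WHOLE FACE AT THE CLOSED LETTER** — `lettersHHZ_pins` with `Bq β := Bh β·e^{δ_Q(ℓ+4)}·c` (the one-term form with nothing to choose).
[cite: Balaban1985BackgroundPropagators, (3.126) p.420 + (3.43) p.398 + (3.153) p.426; Balaban1984PropagatorsII, (2.52)–(2.56) pp.232–233 + Lemma 2.1 (2.61) p.234] -/
theorem lettersHHZ_pins_closed (x : MemberY d ℓ hd hL b₀ b₁ Mstar) {bI : FBondY x.toKIdx → IBondY x.toKIdx}
    (hβ1 : ∀ f : FBondY x.toKIdx, (geomT x.D).dist (β x.hN x.D x.hk (bI f)) (blkV1 x.hN x.D f) ≤ 1)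
    {Y W PX PY P : Type} [Fintype Y] [Fintype W] [Fintype PX] [Fintype PY]
    {𝔬 : Ops (geo9Y x) (bg9Y (Matrix (Fin N) (Fin N) ℂ) (specialUnitaryUnits (Fin N)) x) (XBK (TrIdx N) x.toKIdx) Y (XHK (TrIdx N) x.toKIdx) W}
    {𝔭 : HolderProbes (geo9Y x) (bg9Y (Matrix (Fin N) (Fin N) ℂ) (specialUnitaryUnits (Fin N)) x) (XBK (TrIdx N) x.toKIdx) Y PX PY}
    {Dd Dds : (bg9Y (Matrix (Fin N) (Fin N) ℂ) (specialUnitaryUnits (Fin N)) x).Cfg → P → Module.End ℝ (XBK (TrIdx N) x.toKIdx → ℝ)}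
    {H : Prop} {bHX : ℝ → BlockNorm (toB6 (geo9Y x) 1 H) (XBK (TrIdx N) x.toKIdx → ℝ)}
    {B₀ : ℝ} {Bh Bi : ℝ → ℝ} {Bi2 : ℝ → ℝ → ℝ} {δ₀ σ c δ₃ δQ c35 α₀ : ℝ}
    {U : (bg9Y (Matrix (Fin N) (Fin N) ℂ) (specialUnitaryUnits (Fin N)) x).Cfg}
    (hU : (bg9Y (Matrix (Fin N) (Fin N) ℂ) (specialUnitaryUnits (Fin N)) x).Reg335 c35 α₀ U)
    (hrow : RowSum (toB6 (geo9Y x) 1 H) σ c) (hc : 0 ≤ c) (hBh : ∀ β, 0 ≤ β → β < 1 → 0 ≤ Bh β)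
    (hδQ : 0 ≤ δQ) (hδ₃ : 0 ≤ δ₃) (hδ₃0 : δ₃ ≤ δ₀) (hδ₃Q : δ₃ + σ ≤ δQ)
    (hblk : 𝔬.blk = blkBK x.toKIdx bI) (hblkZ : 𝔬.blkZ = blkHK x.toKIdx)
    (hQs : 𝔬.Qstar U = QscoKH x.toKIdx (trBasis N) (bg9Y (Matrix (Fin N) (Fin N) ℂ) (specialUnitaryUnits (Fin N)) x) (fun U => U) (parBY x.toKIdx) U)
    (hH0 : Thm33G0Dir 𝔬 𝔭 Dd Dds 1 H bHX B₀ Bh Bi Bi2 δ₀ U)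
    (hpl : ∀ y : (geo9Y x).Site, 0 ≤ ((((ℓ + 1 : ℕ) : ℝ) ^ (d + 1)) ^ lvl x.hN x.D x.hk y)⁻¹) :
    LettersHHZ 𝔬 𝔭 1 H (fun y => (geo9Y_len_pos x y).le)
      (weightNorm (BlockNorm.ofBlocks (toB6 (geo9Y x) 1 H) 𝔬.blkZ) (fun y => ((((ℓ + 1 : ℕ) : ℝ) ^ (d + 1)) ^ lvl x.hN x.D x.hk y)⁻¹) hpl)
      (fun β => Bh β * Real.exp (δQ * ((ℓ : ℝ) + 4)) * c) δ₃ U :=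
  lettersHHZ_pins x hβ1 hU hrow hc hBh hδQ hδ₃ hδ₃0 hδ₃Q (fun _ _ _ => le_rfl) hblk hblkZ hQs hH0 hpl

end Literature.MathematicalPhysics.QuantumFieldTheory.Balaban1983to89.B9LettersHHZWholeAtPins

end
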